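import Mathlib

/-!
# Theorem 8.1 (F3) — the five-mark base case of the equality locus of (HCOV), in the kernel
(blind cell PercRepro2, lead g18; proofs/LEAD-SEP3.md §7″–§8)

LEAD-SEP3 Theorem 8.1: for a finite loopless multigraph with five distinct marks `o, a₁, a₂, a₃, b`,
`Gc ≡ 0` as a polynomial in the edge weights iff the graph lies in one of the five classes
(SEP-2), (SEP-3)(i) (+ mirror), (A3-O), (ONE-ROOT)(i) (+ mirror); off the classes the graph contains
one of the NINE WITNESSES of §7″ as a pinning minor. The proof reduces (F2) to SIMPLE GRAPHS ON
EXACTLY THE FIVE MARKS, and (F3) is the finite base case: every one of the `2^10 = 1024` edge sets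
that is off-class contains a witness as a subgraph, and no in-class edge set does. This file checks
(F3) in the kernel, with the class predicates written as the graph-separation statements of
§1–§2 / §4′ and the nine witnesses as edge sets.

Vertices `0 = o`, `1 = a₁`, `2 = a₂`, `3 = a₃`, `4 = b`; the ten pairs are indexed
`01 ↦ 0, 02 ↦ 1, 03 ↦ 2, 04 ↦ 3, 12 ↦ 4, 13 ↦ 5, 14 ↦ 6, 23 ↦ 7, 24 ↦ 8, 34 ↦ 9`; a simple graph
is a bitmask `g < 1024`; vertex sets are bitmasks over `0..4`. «`X` separates `y` from `z`» means
`z` is not reachable from `y` in `g − X` (five expansion steps suffice on five vertices).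

Classes (each a conjunction of separation statements with `X ⊆ {a₁, a₂, a₃}`):
* (SEP-2): `{a₁, a₂}` separates `o` from `b`;
* (SEP-3)(i): `{a₁, a₃}` separates `o` from `a₂` and from `b`; mirror `a₁ ↔ a₂`;
* (A3-O): `{a₃}` separates `o` from `a₁` and from `a₂` (contains «`o` in a rootless component»);
* (ONE-ROOT)(i): `{a₂}` separates `a₁` from `o`, `b`, `a₃`; mirror `a₁ ↔ a₂`.

Witnesses (§7″): the paths `a₁o·ob·ba₂`, `a₂o·ob·ba₁`; the stars `oa₁·oa₂·ob`, `ba₁·ba₂·bo`; the four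
P3-plus-edge shapes `ob·ba₁·a₂a₃`, `ob·ba₂·a₁a₃`, `ob·oa₁·a₂a₃`, `ob·oa₂·a₁a₃`; the four-edge
`oa₁·oa₂·oa₃·a₃b`.

Results (all `decide +kernel`, standard axioms only): `offClass_hasWitness` (416 off-class graphs,
each with a witness subgraph), `inClass_noWitness` (608 in-class graphs, none with a witness), the
two counts, and `minimal_iff_witness`: the deletion-minimal off-class graphs are EXACTLY the nine
witness edge sets (engine D142's one-line (F3)). Same numbers as mining/lead/g17/ladder/base_case.out
(lead g17, one code) and engine D142 (second code).
-/

namespace Summit.Ventures.PercRepro2.FiveMarkBaseCase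

/-- The ten vertex pairs of the five marks, in the order `01 02 03 04 12 13 14 23 24 34`. -/
def pair : Nat → Nat × Nat
  | 0 => (0, 1)
  | 1 => (0, 2)
  | 2 => (0, 3)
  | 3 => (0, 4)
  | 4 => (1, 2)
  | 5 => (1, 3)
  | 6 => (1, 4)
  | 7 => (2, 3)
  | 8 => (2, 4)
  | _ => (3, 4)

/-- Pair `i` is an edge of the graph `g` iff bit `i` of `g` is set. -/
def hasEdge (g i : Nat) : Bool := g.testBit i

/-- Vertex-set membership: `x ∈ S` iff bit `x` of `S` is set. -/
def mem (S x : Nat) : Bool := S.testBit x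

/-- One expansion step of the vertex set `S` along the edges of `g`, never entering `X`. -/
def step (g X S : Nat) : Nat :=
  (List.range 10).foldl (fun S i =>
    if hasEdge g i then
      let e := pair i
      let S₁ := if mem S e.1 && !mem X e.2 then S ||| (1 <<< e.2) else S
      if mem S₁ e.2 && !mem X e.1 then S₁ ||| (1 <<< e.1) else S₁
    else S) S

/-- `n`-fold iteration of `step g X`. -/
def iter (g X : Nat) : Nat → Nat → Nat
  | 0, S => S
  | n + 1, S => iter g X n (step g X S)

/-- The vertices reachable from `y` in `g − X` (`y ∉ X`); five steps suffice on five vertices. -/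
def reach (g X y : Nat) : Nat := iter g X 5 (1 <<< y)

/-- (SEP-2): `X = {a₁, a₂}` (bits 1, 2) separates `o = 0` from `b = 4`. -/
def SEP2 (g : Nat) : Bool := !mem (reach g 6 0) 4

/-- (SEP-3)(i): `X = {a₁, a₃}` (bits 1, 3) separates `o` from `a₂ = 2` and from `b = 4`. -/
def SEP3 (g : Nat) : Bool := let R := reach g 10 0; !mem R 2 && !mem R 4

/-- (SEP-3)(i) mirror: `X = {a₂, a₃}` (bits 2, 3) separates `o` from `a₁ = 1` and from `b`. -/
def SEP3m (g : Nat) : Bool := let R := reach g 12 0; !mem R 1 && !mem R 4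

/-- (A3-O): `X = {a₃}` (bit 3) separates `o` from `a₁` and from `a₂`. -/
def A3O (g : Nat) : Bool := let R := reach g 8 0; !mem R 1 && !mem R 2

/-- (ONE-ROOT)(i): `X = {a₂}` (bit 2) separates `a₁ = 1` from `o`, `b`, `a₃`. -/
def ONEROOT (g : Nat) : Bool := let R := reach g 4 1; !mem R 0 && !mem R 4 && !mem R 3

/-- (ONE-ROOT)(i) mirror: `X = {a₁}` (bit 1) separates `a₂ = 2` from `o`, `b`, `a₃`. -/
def ONEROOTm (g : Nat) : Bool := let R := reach g 2 2; !mem R 0 && !mem R 4 && !mem R 3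

/-- The graph lies in one of the five classes (with both mirrors). -/
def inClass (g : Nat) : Bool := SEP2 g || SEP3 g || SEP3m g || A3O g || ONEROOT g || ONEROOTm g

/-- An edge set from a list of pair indices. -/
def edges (l : List Nat) : Nat := l.foldl (fun g i => g ||| (1 <<< i)) 0

/-- The nine witnesses of §7″ as edge sets. -/
def witnesses : List Nat :=
  [ edges [0, 3, 8],      -- a₁o·ob·ba₂      = {01, 04, 24}
    edges [1, 3, 6],      -- a₂o·ob·ba₁      = {02, 04, 14}
    edges [0, 1, 3],      -- oa₁·oa₂·ob      = {01, 02, 04}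
    edges [6, 8, 3],      -- ba₁·ba₂·bo      = {14, 24, 04}
    edges [3, 6, 7],      -- ob·ba₁·a₂a₃     = {04, 14, 23}
    edges [3, 8, 5],      -- ob·ba₂·a₁a₃     = {04, 24, 13}
    edges [3, 0, 7],      -- ob·oa₁·a₂a₃     = {04, 01, 23}
    edges [3, 1, 5],      -- ob·oa₂·a₁a₃     = {04, 02, 13}
    edges [0, 1, 2, 9] ]  -- oa₁·oa₂·oa₃·a₃b = {01, 02, 03, 34}

/-- `g` contains a witness as a subgraph (edge-set inclusion). -/
def hasWitness (g : Nat) : Bool := witnesses.any (fun w => w &&& g == w)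

/-- `g` is off-class and every single-edge deletion is in-class. -/
def deletionMinimal (g : Nat) : Bool :=
  !inClass g && (List.range 10).all (fun i => !hasEdge g i || inClass (g ^^^ (1 <<< i)))

/-- **(F3), first half**: every off-class simple graph on the five marks contains a witness. -/
theorem offClass_hasWitness : ∀ g < 1024, inClass g = false → hasWitness g = true := by
  decide +kernel

/-- **(F3), second half** (consistency of the classifier with the ⟸ half of Theorem 8.1): no
in-class graph contains a witness. -/
theorem inClass_noWitness : ∀ g < 1024, inClass g = true → hasWitness g = false := by
  decide +kernel

/-- 416 of the 1,024 five-mark graphs are off-class. -/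
theorem count_offClass : (List.range 1024).countP (fun g => !inClass g) = 416 := by
  decide +kernel

/-- 608 are in-class. -/
theorem count_inClass : (List.range 1024).countP (fun g => inClass g) = 608 := by
  decide +kernel

/-- The nine witnesses are pairwise distinct, off-class, and each contains itself. -/
theorem witnesses_offClass : witnesses.all (fun w => !inClass w && hasWitness w) = true := by
  decide +kernel

/-- **Deletion-minimal off-class graphs are exactly the nine witnesses** (engine D142's one-line
(F3)). -/
theorem minimal_iff_witness :
    ∀ g < 1024, deletionMinimal g = true ↔ g ∈ witnesses := by
  decide +kernel

end Summit.Ventures.PercRepro2.FiveMarkBaseCase
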